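import Mathlib.Analysis.InnerProductSpace.Projection.FiniteDimensional
import Literature.AlgebraicTopology.CharacteristicClasses.ProjectiveSpaceLowHomology
import Literature.AlgebraicTopology.SingularHomology.CompactSupports
import HarnessLib

/-!
# `H₁(ℙ(H)) = 0` and `H₂(ℂP¹) ↠ H₂(ℙ(H))` for the projective space of a Hilbert space

Topic `Literature/AlgebraicTopology/CharacteristicClasses`. For a complex Hilbert space `H`
(an inner product space, possibly infinite-dimensional, non-separable, incomplete) and a projective line
`ι : ℂP¹ = OnePoint ℂ → ℙ(H)` (`projectiveLine e₀ e₁ φ₀ φ₁`):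

* `isZero_singularHomology_projectivization_hilbert_one` — **`H₁(ℙ(H); M) = 0`**;
* `singularHomology_map_projectiveLine_two_surjective` — **`ι_* : H₂(ℂP¹; M) → H₂(ℙ(H); M)` is
  onto**.

`ℙ(H)` is the union of the open sets `{[v] | P_W v ≠ 0}` (`projChart`, `P_W` the orthogonal
projection) over the finite-dimensional subspaces `W ∋ e₀, e₁`, a directed family, and each of
them deformation retracts onto `ℙ(W)` (`ProjectiveDeformation`); a singular homology class has
compact support (the tree's `singularHomology.exists_isCompact_mem_range_map`, Hatcher Prop. 2.6 /
proof of 3.33), so it comes from one `{P_W ≠ 0} ≃ ℙ(W)`, where `H₁ = 0` and `H₂` is hit by the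
line (`ProjectiveSpaceLowHomology`). This is the passage `ℂP^∞ = ⋃ ℂPⁿ` of A. Hatcher, *Algebraic
Topology* (2002), Ch. 0 p. 7, in the Hilbert-space model of `ℂP^∞` used for the classification
of line bundles.

Everything is proved; no named facts.

## References

* A. Hatcher, *Algebraic Topology*, CUP 2002, Ch. 0 p. 7 (`ℂP^∞`), Prop. 2.6 and proof of
  Prop. 3.33 (compact supports). [Hatcher2002]
-/

noncomputable section

open Function Set Filter Topology Module CategoryTheory
open Literature.AlgebraicTopology.SingularHomology
open scoped LinearAlgebra.Projectivization OnePoint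

universe v

namespace Literature.AlgebraicTopology.CharacteristicClasses

variable (R : Type v) [CommRing R] (M : Type v) [AddCommGroup M] [Module R M]
variable {H : Type} [NormedAddCommGroup H] [InnerProductSpace ℂ H]

/-! ### The open sets `{P_W ≠ 0}` -/

section Charts

/-- The orthogonal projection onto `W` is a projection. [folklore] -/
theorem starProjection_idem (W : Submodule ℂ H) [W.HasOrthogonalProjection] (v : H) :
    W.starProjection (W.starProjection v) = W.starProjection v :=
  congrArg (fun f : H →L[ℂ] H ↦ f v) W.isIdempotentElem_starProjection.eq

/-- Monotonicity: `W ≤ W'` gives `{P_W ≠ 0} ⊆ {P_{W'} ≠ 0}` (`P_W = P_W ∘ P_{W'}`). [folklore] -/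
theorem projChart_starProjection_mono {W W' : Submodule ℂ H} [W.HasOrthogonalProjection]
    [W'.HasOrthogonalProjection] (h : W ≤ W') :
    projChart W.starProjection ⊆ projChart W'.starProjection := by
  intro p hp
  induction p with
  | h v hv =>
    rw [mk_mem_projChart_iff] at hp ⊢
    intro h0
    apply hp
    have := congrArg (fun f : H →L[ℂ] H ↦ f v) (Submodule.starProjection_comp_starProjection_of_le h)
    change W.starProjection (W'.starProjection v) = W.starProjection v at this
    rw [← this, h0, map_zero]

/-- A point `[v]` with `v ∈ W` lies in `{P_W ≠ 0}` (`P_W v = v`). [folklore] -/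
theorem mk_mem_projChart_of_mem (W : Submodule ℂ H) [W.HasOrthogonalProjection] {v : H}
    (hvW : v ∈ W) (hv : v ≠ 0) : Projectivization.mk ℂ v hv ∈ projChart W.starProjection := by
  rw [mk_mem_projChart_iff, Submodule.starProjection_eq_self_iff.2 hvW]
  exact hv

end Charts

/-! ### A homology class lives on one `{P_W ≠ 0}` -/

/-- **Compact supports**: every class of `H_k(ℙ(H); M)` is the image of a class of
`H_k({P_W ≠ 0}; M)` for some finite-dimensional `W` containing two given vectors (cover the compact
support by finitely many `{P_{span{e₀,e₁,v}} ≠ 0}` and take the span of the `W`'s).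
[cite: Hatcher2002, Prop. 2.6 and proof of Prop. 3.33] -/
theorem exists_mem_range_map_projChart (e₀ e₁ : H) {k : ℕ} (z : singularHomology R M (ℙ ℂ H) k) :
    ∃ W : Submodule ℂ H, FiniteDimensional ℂ W ∧ e₀ ∈ W ∧ e₁ ∈ W ∧
      ∀ [W.HasOrthogonalProjection],
        z ∈ Set.range (singularHomology.map R M (subsetIncl (projChart W.starProjection)) k) := by
  classical
  obtain ⟨C, hC, zC, rfl⟩ := singularHomology.exists_isCompact_mem_range_map (R := R) (M := M) z
  -- cover `C` by the charts of the spans `span {e₀, e₁, rep p}`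
  let Wp : ℙ ℂ H → Submodule ℂ H := fun p ↦ Submodule.span ℂ ({e₀, e₁, p.rep} : Set H)
  haveI hWp : ∀ p, FiniteDimensional ℂ ↥(Wp p) := fun p ↦
    FiniteDimensional.span_of_finite ℂ (Set.toFinite _)
  obtain ⟨t, ht⟩ := hC.elim_finite_subcover (fun p ↦ projChart (Wp p).starProjection)
    (fun p ↦ isOpen_projChart _) fun p _ ↦ mem_iUnion.2 ⟨p, by
      have h := mk_mem_projChart_of_mem (Wp p) (Submodule.subset_span (by simp)) p.rep_nonzero
      rwa [p.mk_rep] at h⟩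
  -- the span of the finitely many `W`'s (and of `e₀, e₁`)
  let W : Submodule ℂ H := Submodule.span ℂ ({e₀, e₁} : Set H) ⊔ t.sup Wp
  haveI hW : FiniteDimensional ℂ ↥W := by
    haveI : FiniteDimensional ℂ ↥(Submodule.span ℂ ({e₀, e₁} : Set H)) :=
      FiniteDimensional.span_of_finite ℂ (Set.toFinite _)
    haveI : FiniteDimensional ℂ ↥(t.sup Wp) := Submodule.finiteDimensional_finset_sup _ _
    exact Submodule.finiteDimensional_sup _ _
  refine ⟨W, hW, le_sup_left (a := Submodule.span ℂ ({e₀, e₁} : Set H))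
    (Submodule.subset_span (by simp)), le_sup_left (a := Submodule.span ℂ ({e₀, e₁} : Set H))
    (Submodule.subset_span (by simp)), fun {_} ↦ ?_⟩
  have hCW : C ⊆ projChart W.starProjection := by
    refine ht.trans (iUnion₂_subset fun p hp ↦ ?_)
    exact projChart_starProjection_mono ((Finset.le_sup hp).trans le_sup_right)
  refine ⟨singularHomology.map R M (subsetInclusion hCW) k zC, ?_⟩
  rw [← ModuleCat.comp_apply, ← singularHomology.map_comp]
  rfl

/-! ### On `{P_W ≠ 0} ≃ ℙ(W)`: `H₁ = 0` and `H₂` is hit by the line -/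

section OnChart

variable (e₀ e₁ : H) (φ₀ φ₁ : StrongDual ℂ H)
  (h₀₀ : φ₀ e₀ = 1) (h₀₁ : φ₀ e₁ = 0) (h₁₀ : φ₁ e₀ = 0) (h₁₁ : φ₁ e₁ = 1)
  (W : Submodule ℂ H) [FiniteDimensional ℂ W] (he₀ : e₀ ∈ W) (he₁ : e₁ ∈ W)

/-- `range P_W = W` is finite-dimensional. [folklore] -/
instance finiteDimensional_range_starProjection :
    FiniteDimensional ℂ ↥(LinearMap.range (W.starProjection : H →ₗ[ℂ] H)) := by
  rw [show LinearMap.range (W.starProjection : H →ₗ[ℂ] H) = W from Submodule.range_starProjection W]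
  infer_instance

include he₀ in
/-- `e₀ ∈ range P_W`. [folklore] -/
theorem mem_range_starProjection : e₀ ∈ LinearMap.range (W.starProjection : H →ₗ[ℂ] H) :=
  ⟨e₀, Submodule.starProjection_eq_self_iff.2 he₀⟩

include h₀₀ h₀₁ h₁₀ h₁₁ he₀ he₁ in
/-- The projective line of `ℙ(H)` factors through `ℙ(range P_W) ≅ rangeLocus ↪ {P_W ≠ 0} ↪ ℙ(H)`.
[folklore] -/
theorem projectiveLine_eq_comp :
    projectiveLine e₀ e₁ φ₀ φ₁ h₀₀ h₀₁ h₁₀ h₁₁ =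
      (subsetIncl (projChart W.starProjection)).comp
        ((rangeLocusInclusion W.starProjection).comp
          ((rangeLocusHomeomorph W.starProjection (starProjection_idem W) : C(_, _)).comp
            (projectiveLine
              (⟨e₀, mem_range_starProjection e₀ W he₀⟩ : ↥(LinearMap.range (W.starProjection : H →ₗ[ℂ] H)))
              ⟨e₁, mem_range_starProjection e₁ W he₁⟩
              (φ₀.comp (Submodule.subtypeL _)) (φ₁.comp (Submodule.subtypeL _)) h₀₀ h₀₁ h₁₀ h₁₁))) := by
  ext x : 1
  induction x using OnePoint.rec with
  | infty => rfl
  | coe t => rfl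

include e₀ e₁ φ₀ φ₁ h₀₀ h₀₁ h₁₀ h₁₁ he₀ he₁ in
/-- `H₁({P_W ≠ 0}; M) = 0` (`≃ ℙ(W)`, finite-dimensional with a line). [cite: Hatcher2002, Ch. 0 p. 7] -/
theorem isZero_singularHomology_projChart_one :
    Limits.IsZero (singularHomology R M ↥(projChart W.starProjection) 1) := by
  have hP := starProjection_idem W
  haveI := isIso_singularHomology_map_rangeLocusInclusion W.starProjection R M hP 1
  have h0 := isZero_singularHomology_projectivization_one R M
    (⟨e₀, mem_range_starProjection e₀ W he₀⟩ : ↥(LinearMap.range (W.starProjection : H →ₗ[ℂ] H)))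
    ⟨e₁, mem_range_starProjection e₁ W he₁⟩
    (φ₀.comp (Submodule.subtypeL _)) (φ₁.comp (Submodule.subtypeL _)) h₀₀ h₀₁ h₁₀ h₁₁
  exact (h0.of_iso (singularHomology.mapIso R M
    (rangeLocusHomeomorph W.starProjection hP) 1).symm).of_iso
      (asIso (singularHomology.map R M (rangeLocusInclusion W.starProjection) 1)).symm

include h₀₀ h₀₁ h₁₀ h₁₁ he₀ he₁ in
/-- Every class of `H₂({P_W ≠ 0}; M)` maps into the image of the line in `H₂(ℙ(H); M)`.
[cite: Hatcher2002, Ch. 0 p. 7] -/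
theorem map_projChart_two_mem_range (y : singularHomology R M ↥(projChart W.starProjection) 2) :
    singularHomology.map R M (subsetIncl (projChart W.starProjection)) 2 y ∈
      Set.range (singularHomology.map R M (projectiveLine e₀ e₁ φ₀ φ₁ h₀₀ h₀₁ h₁₀ h₁₁) 2) := by
  have hP := starProjection_idem W
  haveI hi := isIso_singularHomology_map_rangeLocusInclusion W.starProjection R M hP 2
  haveI hl := isIso_singularHomology_map_projectiveLine_two R M
    (⟨e₀, mem_range_starProjection e₀ W he₀⟩ : ↥(LinearMap.range (W.starProjection : H →ₗ[ℂ] H)))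
    ⟨e₁, mem_range_starProjection e₁ W he₁⟩
    (φ₀.comp (Submodule.subtypeL _)) (φ₁.comp (Submodule.subtypeL _)) h₀₀ h₀₁ h₁₀ h₁₁
  -- the composite `H₂(ℂP¹) → H₂(ℙ(range P)) ≅ H₂(rangeLocus) ≅ H₂({P ≠ 0})` is onto
  set g := singularHomology.map R M (projectiveLine
      (⟨e₀, mem_range_starProjection e₀ W he₀⟩ : ↥(LinearMap.range (W.starProjection : H →ₗ[ℂ] H)))
      ⟨e₁, mem_range_starProjection e₁ W he₁⟩
      (φ₀.comp (Submodule.subtypeL _)) (φ₁.comp (Submodule.subtypeL _)) h₀₀ h₀₁ h₁₀ h₁₁) 2 ≫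
    singularHomology.map R M (rangeLocusHomeomorph W.starProjection hP : C(_, _)) 2 ≫
      singularHomology.map R M (rangeLocusInclusion W.starProjection) 2 with hg
  haveI : IsIso g := by
    rw [hg, ← singularHomology.mapIso_hom]
    infer_instance
  obtain ⟨w, hw⟩ := (asIso g).toLinearEquiv.surjective y
  change g w = y at hw
  refine ⟨w, ?_⟩
  rw [projectiveLine_eq_comp e₀ e₁ φ₀ φ₁ h₀₀ h₀₁ h₁₀ h₁₁ W he₀ he₁, singularHomology.map_comp,
    singularHomology.map_comp, singularHomology.map_comp, ← hw, hg]
  rfl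

end OnChart

/-! ### Conclusion -/

section Main

variable (e₀ e₁ : H) (φ₀ φ₁ : StrongDual ℂ H)
  (h₀₀ : φ₀ e₀ = 1) (h₀₁ : φ₀ e₁ = 0) (h₁₀ : φ₁ e₀ = 0) (h₁₁ : φ₁ e₁ = 1)

include e₀ e₁ φ₀ φ₁ h₀₀ h₀₁ h₁₀ h₁₁ in
/-- **`H₁(ℙ(H); M) = 0`** for a complex Hilbert space `H` containing a projective line
(Hatcher 2002, Ch. 0 p. 7: `ℂP^∞ = ⋃ ℂPⁿ` and `H₁(ℂPⁿ) = 0`; compact supports).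
[cite: Hatcher2002, Ch. 0 p. 7] -/
theorem isZero_singularHomology_projectivization_hilbert_one :
    Limits.IsZero (singularHomology R M (ℙ ℂ H) 1) := by
  have hz : ∀ z : singularHomology R M (ℙ ℂ H) 1, z = 0 := by
    intro z
    obtain ⟨W, hW, he₀, he₁, hzW⟩ := exists_mem_range_map_projChart R M e₀ e₁ z
    haveI := hW
    obtain ⟨y, rfl⟩ := hzW
    haveI := ModuleCat.subsingleton_of_isZero
      (isZero_singularHomology_projChart_one R M e₀ e₁ φ₀ φ₁ h₀₀ h₀₁ h₁₀ h₁₁ W he₀ he₁)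
    rw [Subsingleton.elim y 0, map_zero]
  haveI : Subsingleton (singularHomology R M (ℙ ℂ H) 1) := ⟨fun a b ↦ (hz a).trans (hz b).symm⟩
  exact ModuleCat.isZero_of_subsingleton _

/-- **The projective line is onto on `H₂`**: `ι_* : H₂(ℂP¹; M) → H₂(ℙ(H); M)` is surjective for a
complex Hilbert space `H` (Hatcher 2002, Ch. 0 p. 7: `H₂(ℂP¹) ≅ H₂(ℂPⁿ) ≅ H₂(ℂP^∞)`; compact
supports). [cite: Hatcher2002, Ch. 0 p. 7] -/
theorem singularHomology_map_projectiveLine_two_surjective :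
    Function.Surjective (singularHomology.map R M (projectiveLine e₀ e₁ φ₀ φ₁ h₀₀ h₀₁ h₁₀ h₁₁) 2) := by
  intro z
  obtain ⟨W, hW, he₀, he₁, hzW⟩ := exists_mem_range_map_projChart R M e₀ e₁ z
  haveI := hW
  obtain ⟨y, rfl⟩ := hzW
  exact map_projChart_two_mem_range R M e₀ e₁ φ₀ φ₁ h₀₀ h₀₁ h₁₀ h₁₁ W he₀ he₁ y

end Main

end Literature.AlgebraicTopology.CharacteristicClasses
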